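import Summits.QuantumFields.YangMills.Theorems.BalabanUVNodesN07WindowGuardOfFineLetter
import Summits.QuantumFields.YangMills.Theorems.BalabanUVNodesN07TowerGaugeCoverLiftWindow
import Summits.QuantumFields.YangMills.Theorems.BalabanUVNodesN07AxialTowerRepresentative
import Literature.MathematicalPhysics.QuantumFieldTheory.Balaban1983to89.Node00.TorusCoverCubeMemberRecordDentZd
import Literature.MathematicalPhysics.QuantumFieldTheory.Balaban1983to89.Node00.CarriersB8CubeDentedRec
import HarnessLib

/-!
# N07 [B11] (= [15] = [Balaban1985Variational]) Sect. F ∕ [6] (1.14)–(1.15), p. 98 ∕ [I] (0.4) — MODULE 138 (ASK-6 of the φ-junction): **THE R7 DOOR's CLAMPED TOWER GAUGE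
# `vfix` OF A DENTED RECORD CUBE IS THE LIFT OF AN HONEST TORUS GAUGE WITH A RADIALLY AXIAL TOWER** — the `hvfix` AND `hax₂` binders of dag-n07-w3's ✓p760822
# `…N07SymPhiTorusRowAtRecordCubeCell.torusRow_at_recordCube_cell` SUPPLIED at `c := recordCubePZ (F.P K) j hj1 hk Mc ρ hρ idx Dtop` from the datum's fine letter

Cell `pub-ymgap`, seat `pub-ymgap-dag-n07-e` g33 (FAN-OUT §N07 row s3; LANE OWNER of the K0 road chart side; ASK-6 per director-ym №330).  `--kind proof --supports
stmt-QuantumFields-20541 --as helper` (K0⁷; count-neutral).  THEOREMS ONLY (0 `def`).  [15] = [Balaban1985Variational]; [6] = [Balaban1985RegularSpaces]; [I] = [Balaban1987RG1].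

WHY.  Row 9′ per cell (✓p760822) reads the GUARDED torus average of `g₁·u′⁻¹`; its glue identity needs the door's member formula (`hsid`, MODULES 130∕131) AND `hvfix : c.vfix V x =
ιSU(g₂(π(x + c_j·𝟙)))` on `Ω′₀ = c.sq 0`, with `M^n(U^{g₂})` radially axial for `n < j` (`hax₂`) so that the τ-side (✓p757516 ∕ ✓p758311 ∕ ✓p759262) applies to the pair `(g₁, g₂)`.
THIS FILE produces `g₂ := h̄·w`: `w` the residual radial axial tower of `U` (dag-n07-w6 ✓`…N07AxialTowerRepresentative.exists_residual_axialTower` at `avOfRecord F N K` and the radial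
contour data), `h̄ = blockLift j (axialGaugeAt (M^j(U^w)) (tLo a ρ) (tHi a M ρ) (ctr a M))` the block-constant lift of pv26's rooted axial gauge of the top average (g12's FILE-2), so
`hax₂` is ✓`axialTower_gaugeAct_blockLift`, and `hvfix` is g12's ✓`localGaugeZ_coverLiftShift_eq_of_mem_tcubeZ` — whose (0.4) window guard `hs` is MODULE 137
✓`…N07WindowGuardOfFineLetter.windowSmall_of_fineLetter` from the fine letter `PlaqSmallOn (plaqsOf Ω_c) a₀ U` + collar `π '' □̃ ⊆ Ω_c` (the SAME two hypotheses `hU`∕`hcollar` of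
✓p760822), `1 ≤ sideP`, and the no-wrap `sideP + 4ρ ≤ sitesPerDir j` from the knit's guard row `Mc + 11d + 6ρ ≤ sitesPerDir j` (✓`sideP_le`); `Ω′₀ ⊆ □₀ᶻ ⊆ □̃ᶻ` by dag-n05-e's
`CubeB8DZ.sq_subset_cube` + `B8Eq131CubesRec.cube_subset_tcube`.

WHAT IS PROVED (sorry-free; axioms standard).  `three_le_sitesPerDir_of_guard`; ★★★ `exists_radialGauge_vfix_at_recordCube` — for the dented record cube and a torus field `U` with the
fine letter on `Ω_c ⊇ π '' □̃` (`0 < a₀`), the guard row and MODULE 137's three per-level rows (`i < j`): `∃ g₂ : GaugeTransf (F.P K) 0 (SU N)` with `hax₂` (VERBATIM ✓p760822's binder,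
`c.k ≡ j`) and `hvfix` on `c.sq 0` (VERBATIM ✓p760822's binder with `vfixV := c.vfix V`, `V x μ = ιSU(U ⟨π(x + c_j·𝟙), μ⟩)`); ★★ `exists_radialGauge_vfix_at_recordCube_residual` (the same,
also exporting `IsResidual j w`, `g₂ = h̄·w` with `h̄` block-constant from level `j` — for consumers that track the carrier).
HONEST FRAMING: count-neutral composition of landed names (g12 §5, dag-n07-w6's axial tower, MODULE 137); the fine letter, the collar, the guard row and the three numeric rows remain
DISPLAYED hypotheses (the knit's (17) at `Ω_{j−1}`, (144), the guard, ASK-7); nothing of [15]∕[6]∕[I] analysis asserted; `hJ` ∕ `DatumCrownPhiAt` ∕ `hsup` ∕ HSEAM inhabited by nobody;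
`NrmSymPhiOfRecord` ∕ `HThm4RecSym152PhiEG` ∕ `HThm4Rec*` UNDISCHARGED; N05 ∕ N07 NOT discharged; K0⁷ ∕ K1⁹ NOT closed; counts unmoved (typed 28∕28 · discharged 8∕28); one finite 𝕋⁴
programme at fixed ε — R4 closes the conditional finite-𝕋⁴ rung `BalabanLadder.UV` only; the YM mass gap (Clay) is NOT proved by any of this; nothing continuum ∕ ℝ⁴ ∕ OS.
No `def`, no `instance`, no `notation`, no `sorry`.

References: [6] (1.14)–(1.15) p. 78, p. 98, Prop. 6 (1.130) p. 99; [15] (144) p. 300, (147)–(150) p. 301, (181) p. 307; [I] (0.1) p. 251, (0.3)–(0.4) pp. 252–253, (0.21) p. 256.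
-/

set_option autoImplicit false

noncomputable section

open scoped Matrix.Norms.L2Operator

namespace Summit.QuantumFields.YangMills.BalabanUVNodes.N07RecordCubeVfixTorusGauge

open Literature.MathematicalPhysics.QuantumFieldTheory.Balaban1983to89
open Literature.MathematicalPhysics.QuantumFieldTheory.Balaban1983to89.Node00
open Summit.QuantumFields.Balaban3D.Carriers (radialContourData)
open T4Continuum (T4Family)
open B14DomainGeom (Pt)
open B15Eq112TorusCover (cover)
open B12GaugeOrbits021 (IsResidual)
open B15Eq177GaugeInvariance (blockLift)
open T4AxialGaugeRooted (axialGaugeAt)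
open GaugeField (gaugeAct)
open ExpMeanLog (expMeanLogSU deltaSU)
open BlockAveraging (blockAvg)
open BlockAveragingZd (ctrShift)
open B8Eq17ClassAkV1 (plaqsOf)
open B8Eq131Cubes (tcube tLo tHi ctr)
open Summit.QuantumFields.YangMills.BalabanUVNodes.N07AxialTowerRepresentative (exists_residual_axialTower axialTower_gaugeAct_blockLift)
open Summit.QuantumFields.YangMills.BalabanUVNodes.N07TowerGaugeCoverLiftWindow (localGaugeZ_coverLiftShift_eq_of_mem_tcubeZ)
open Summit.QuantumFields.YangMills.BalabanUVNodes.N07WindowGuardOfFineLetter (windowSmall_of_fineLetter two_mul_L_lt_sitesPerDir_of_lt)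

variable (F : T4Family) (N : ℕ) [NeZero N]

/-- The knit's no-wrap row `Mc + 11d + 6ρ ≤ sitesPerDir j` gives `3 ≤ sitesPerDir j` (`d = 4` at the record). [cite: Balaban1987RG1, (0.1) p.251 (bookkeeping)] -/
theorem three_le_sitesPerDir_of_guard (K : ℕ) {j Mc ρ : ℕ} (hg : Mc + 11 * (F.P K).d + 6 * ρ ≤ (F.P K).sitesPerDir j) : 3 ≤ (F.P K).sitesPerDir j := by
  rw [T4Family.P_d] at hg; omega

/-- ★★ **`vfix` IS THE LIFT OF `h̄·w`, WITH THE CARRIER TRACKED**: for the dented record cube `c := recordCubePZ (F.P K) j hj1 hk Mc ρ hρ idx Dtop`, a torus field `U`, the fine letter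
`PlaqSmallOn (plaqsOf Ω_c) a₀ U` (`0 < a₀`) with `π '' □̃ ⊆ Ω_c`, the guard row `Mc + 11d + 6ρ ≤ sitesPerDir j`, and MODULE 137's three rows at every `i < j`: there are a RESIDUAL `w`
(`IsResidual j w`) with `M^i(U^w)` radially axial for `i < j`, and — with `h̄ := blockLift j (axialGaugeAt (M^j(U^w)) (tLo c.a ρ) (tHi c.a c.M ρ) (ctr c.a c.M))` — the torus gauge
`g₂ := h̄·w` has `M^n(U^{g₂})` radially axial for `n < j` AND `c.vfix V x = ιSU(g₂(π(x + c_j·𝟙)))` for every `x ∈ c.sq 0`.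
[cite: Balaban1985RegularSpaces, (1.14)–(1.15) p.78, p.98; Balaban1985Variational, (147)–(150) p.301, (181) p.307; Balaban1987RG1, (0.3)–(0.4) pp.252–253, (0.21) p.256] -/
theorem exists_radialGauge_vfix_at_recordCube_residual (K : ℕ) {j : ℕ} (hj1 : 1 ≤ j) (hk : j ≤ (F.P K).m + (F.P K).K) (Mc ρ : ℕ) (hρ : (F.P K).L ≤ ρ)
    (idx : Pt (F.P K).d) (Dtop : Finset (Site (F.P K) j)) (U : GaugeField (F.P K) 0 (SU N))
    (hg : Mc + 11 * (F.P K).d + 6 * ρ ≤ (F.P K).sitesPerDir j)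
    {a₀ : ℝ} (ha₀ : 0 < a₀) {Ωc : Set (Site (F.P K) 0)} (hU : PlaqSmallOn (plaqsOf Ωc) a₀ U)
    (hcollar : cover (F.P K) '' tcube (F.P K).L (cornerP (F.P K) Mc ρ idx) (sideP (F.P K) Mc ρ) ρ j ⊆ Ωc)
    (hbud₂ : ∀ i, i < j → 6400 * ((((F.P K).d + 2) * (F.P K).L : ℕ) : ℝ) ^ 2 * ((F.P K).L : ℝ) ^ (i + 1) *
      (((((F.P K).d - 1 : ℕ) : ℝ)) * (((2 * (F.P K).L ^ (i + 1) - 1 : ℕ) : ℝ)) * a₀) ≤ 1)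
    (hgd₂ : ∀ i, i < j → 30 * ((((F.P K).d + 2) * (F.P K).L : ℕ) : ℝ) ^ 2 * ((F.P K).L : ℝ) ^ (i + 1) *
      (((((F.P K).d - 1 : ℕ) : ℝ)) * (((2 * (F.P K).L ^ (i + 1) - 1 : ℕ) : ℝ)) * a₀) < deltaSU (Fin N))
    (hsm₂ : ∀ i, i < j → (((((F.P K).d + 2) * (F.P K).L : ℕ) : ℝ) ^ 2 / 4) * ((4 * (((((F.P K).d - 1 : ℕ) : ℝ)) * ((2 * (F.P K).L - 1 : ℕ) : ℝ)) + 1) *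
      (240 * ((((F.P K).d + 2) * (F.P K).L : ℕ) : ℝ) * ((F.P K).L : ℝ) ^ i * (((((F.P K).d - 1 : ℕ) : ℝ)) * (((2 * (F.P K).L ^ (i + 1) - 1 : ℕ) : ℝ)) * a₀))) < deltaSU (Fin N)) :
    ∃ w : GaugeTransf (F.P K) 0 (SU N), IsResidual j w ∧
      (∀ n, n < j → AxialGauge (radialContourData (F.P K) n (SU N)) (Averaging.iter (avOfRecord F N K) n (gaugeAct w U))) ∧
      (∀ n, n < j → AxialGauge (radialContourData (F.P K) n (SU N)) (Averaging.iter (avOfRecord F N K) n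
        (gaugeAct (fun x => blockLift j (axialGaugeAt (Averaging.iter (avOfRecord F N K) j (gaugeAct w U))
          (tLo (cornerP (F.P K) Mc ρ idx) ρ) (tHi (cornerP (F.P K) Mc ρ idx) (sideP (F.P K) Mc ρ) ρ) (ctr (cornerP (F.P K) Mc ρ idx) (sideP (F.P K) Mc ρ))) x * w x) U))) ∧
      ∀ x ∈ (recordCubePZ (F.P K) j hj1 hk Mc ρ hρ idx Dtop).sq 0,
        letI : CStarAlgebra (MatA N) := {};
        (recordCubePZ (F.P K) j hj1 hk Mc ρ hρ idx Dtop).vfix (fun x μ => ιSU N (U ⟨cover (F.P K) (x + fun _ => ((ctrShift (F.P K).L j : ℕ) : ℤ)), μ⟩)) x =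
          ιSU N ((fun x => blockLift j (axialGaugeAt (Averaging.iter (avOfRecord F N K) j (gaugeAct w U))
            (tLo (cornerP (F.P K) Mc ρ idx) ρ) (tHi (cornerP (F.P K) Mc ρ idx) (sideP (F.P K) Mc ρ) ρ) (ctr (cornerP (F.P K) Mc ρ idx) (sideP (F.P K) Mc ρ))) x * w x)
            (cover (F.P K) (x + fun _ => ((ctrShift (F.P K).L j : ℕ) : ℤ)))) := by
  letI : CStarAlgebra (MatA N) := {}
  have hLo := (F.P K).hL.1
  have hL2 : 2 ≤ (F.P K).L := by have := (F.P K).hL.2; omega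
  have hd : 2 ≤ (F.P K).d := by rw [T4Family.P_d]; norm_num
  have hρ1 : 1 ≤ ρ := le_trans (F.P K).L_pos hρ
  have h3 := three_le_sitesPerDir_of_guard F K hg
  have hN2 : ∀ i, i < j → 2 * (F.P K).L < (F.P K).sitesPerDir i := fun i hi => two_mul_L_lt_sitesPerDir_of_lt hi hk h3
  have hM : 1 ≤ sideP (F.P K) Mc ρ := le_trans hρ1 (Nat.le_mul_of_pos_right ρ (Nat.succ_pos _))
  have hwrap : sideP (F.P K) Mc ρ + 4 * ρ ≤ (F.P K).sitesPerDir j := by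
    have hs := sideP_le (P := F.P K) Mc ρ
    omega
  -- (i) the residual radial axial tower of `U`
  obtain ⟨w, hres, hax⟩ := exists_residual_axialTower (avOfRecord F N K) (fun i => radialContourData (F.P K) i (SU N)) j hk U
  -- (ii) the (0.4) window guard from the fine letter (MODULE 137)
  have hs := windowSmall_of_fineLetter (N := N) hd U (cornerP (F.P K) Mc ρ idx) (sideP (F.P K) Mc ρ) ρ ha₀ hU hcollar hN2 hbud₂ hgd₂ hsm₂
  refine ⟨w, hres, hax, fun n hn => ?_, fun x hx => ?_⟩
  · -- `hax₂`: block-constant lifts from level `j` preserve the axial gauges below `j`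
    have hcomp : gaugeAct (fun x => blockLift j (axialGaugeAt (Averaging.iter (avOfRecord F N K) j (gaugeAct w U))
          (tLo (cornerP (F.P K) Mc ρ idx) ρ) (tHi (cornerP (F.P K) Mc ρ idx) (sideP (F.P K) Mc ρ) ρ) (ctr (cornerP (F.P K) Mc ρ idx) (sideP (F.P K) Mc ρ))) x * w x) U =
        gaugeAct (blockLift j (axialGaugeAt (Averaging.iter (avOfRecord F N K) j (gaugeAct w U))
          (tLo (cornerP (F.P K) Mc ρ idx) ρ) (tHi (cornerP (F.P K) Mc ρ idx) (sideP (F.P K) Mc ρ) ρ) (ctr (cornerP (F.P K) Mc ρ idx) (sideP (F.P K) Mc ρ)))) (gaugeAct w U) :=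
      (B16Sect1Backgrounds.gaugeAct_gaugeAct _ _ _).symm
    rw [hcomp]
    exact axialTower_gaugeAct_blockLift (avOfRecord F N K) (fun i => radialContourData (F.P K) i (SU N)) j hk _ (gaugeAct w U) hax n hn
  · -- `hvfix`: g12 §5 on `□̃ᶻ ⊇ □₀ᶻ ⊇ Ω′₀`
    have hx0 := (recordCubePZ (F.P K) j hj1 hk Mc ρ hρ idx Dtop).sq_subset_cube (j := 0) (Nat.zero_le _) hx
    have hxt := B8Eq131CubesRec.cube_subset_tcube hLo hL2 hρ1 (Nat.zero_le _) hx0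
    exact localGaugeZ_coverLiftShift_eq_of_mem_tcubeZ N hk U w hres hax (cornerP (F.P K) Mc ρ idx) hM hwrap hs hxt

/-- ★★★ **ASK-6 — THE `hvfix` AND `hax₂` BINDERS OF ✓p760822 `torusRow_at_recordCube_cell` AT THE DENTED RECORD CUBE, FROM THE DATUM's FINE LETTER**: under the hypotheses of
`exists_radialGauge_vfix_at_recordCube_residual` there is `g₂ : GaugeTransf (F.P K) 0 (SU N)` with (`hax₂`) `M^n(U^{g₂})` radially axial for every `n < j` and (`hvfix`)
`c.vfix V x = ιSU(g₂(π(x + c_j·𝟙)))` for every `x ∈ c.sq 0`, `c := recordCubePZ (F.P K) j hj1 hk Mc ρ hρ idx Dtop`, `V x μ = ιSU(U ⟨π(x + c_j·𝟙), μ⟩)`.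
[cite: Balaban1985RegularSpaces, (1.14)–(1.15) p.78, p.98, Prop. 6 (1.130) p.99; Balaban1985Variational, (144) p.300, (147)–(150) p.301, (181) p.307; Balaban1987RG1, (0.3)–(0.4) pp.252–253, (0.21) p.256] -/
theorem exists_radialGauge_vfix_at_recordCube (K : ℕ) {j : ℕ} (hj1 : 1 ≤ j) (hk : j ≤ (F.P K).m + (F.P K).K) (Mc ρ : ℕ) (hρ : (F.P K).L ≤ ρ)
    (idx : Pt (F.P K).d) (Dtop : Finset (Site (F.P K) j)) (U : GaugeField (F.P K) 0 (SU N))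
    (hg : Mc + 11 * (F.P K).d + 6 * ρ ≤ (F.P K).sitesPerDir j)
    {a₀ : ℝ} (ha₀ : 0 < a₀) {Ωc : Set (Site (F.P K) 0)} (hU : PlaqSmallOn (plaqsOf Ωc) a₀ U)
    (hcollar : cover (F.P K) '' tcube (F.P K).L (cornerP (F.P K) Mc ρ idx) (sideP (F.P K) Mc ρ) ρ j ⊆ Ωc)
    (hbud₂ : ∀ i, i < j → 6400 * ((((F.P K).d + 2) * (F.P K).L : ℕ) : ℝ) ^ 2 * ((F.P K).L : ℝ) ^ (i + 1) *
      (((((F.P K).d - 1 : ℕ) : ℝ)) * (((2 * (F.P K).L ^ (i + 1) - 1 : ℕ) : ℝ)) * a₀) ≤ 1)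
    (hgd₂ : ∀ i, i < j → 30 * ((((F.P K).d + 2) * (F.P K).L : ℕ) : ℝ) ^ 2 * ((F.P K).L : ℝ) ^ (i + 1) *
      (((((F.P K).d - 1 : ℕ) : ℝ)) * (((2 * (F.P K).L ^ (i + 1) - 1 : ℕ) : ℝ)) * a₀) < deltaSU (Fin N))
    (hsm₂ : ∀ i, i < j → (((((F.P K).d + 2) * (F.P K).L : ℕ) : ℝ) ^ 2 / 4) * ((4 * (((((F.P K).d - 1 : ℕ) : ℝ)) * ((2 * (F.P K).L - 1 : ℕ) : ℝ)) + 1) *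
      (240 * ((((F.P K).d + 2) * (F.P K).L : ℕ) : ℝ) * ((F.P K).L : ℝ) ^ i * (((((F.P K).d - 1 : ℕ) : ℝ)) * (((2 * (F.P K).L ^ (i + 1) - 1 : ℕ) : ℝ)) * a₀))) < deltaSU (Fin N)) :
    ∃ g₂ : GaugeTransf (F.P K) 0 (SU N),
      (∀ n, n < j → AxialGauge (radialContourData (F.P K) n (SU N)) (Averaging.iter (avOfRecord F N K) n (gaugeAct g₂ U))) ∧
      ∀ x ∈ (recordCubePZ (F.P K) j hj1 hk Mc ρ hρ idx Dtop).sq 0,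
        letI : CStarAlgebra (MatA N) := {};
        (recordCubePZ (F.P K) j hj1 hk Mc ρ hρ idx Dtop).vfix (fun x μ => ιSU N (U ⟨cover (F.P K) (x + fun _ => ((ctrShift (F.P K).L j : ℕ) : ℤ)), μ⟩)) x =
          ιSU N (g₂ (cover (F.P K) (x + fun _ => ((ctrShift (F.P K).L j : ℕ) : ℤ)))) := by
  obtain ⟨w, -, -, hax₂, hvfix⟩ := exists_radialGauge_vfix_at_recordCube_residual F N K hj1 hk Mc ρ hρ idx Dtop U hg ha₀ hU hcollar hbud₂ hgd₂ hsm₂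
  exact ⟨_, hax₂, hvfix⟩

end Summit.QuantumFields.YangMills.BalabanUVNodes.N07RecordCubeVfixTorusGauge

end
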